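import Summits.NavierStokesRegularity.NavierStokesRegularity.Theses.WakeRatchet
import Summits.NavierStokesRegularity.NavierStokesRegularity.Theorems.WakeRatchetEternalInviscidRateStubTailLimit

/-!
# Conveyor ledger (crux `WakeRatchet.EternalInviscidRate`, ⟨stmt-NavierStokesRegularity-25646⟩) —
# the tail derivative `T_n′ = F_{n-1}` and the ONE-WAY RUNG of `stub_noSloshing`

Helpers for the registered skeleton «conveyor ledger» (LINE g10-3, sha16 d183ebc25b56, namespace
`…Cruxes.EternalInviscidRate.FinalWakeLedger`; stubs `stub_wakeLimit`/`stub_tailLimit` landed, `stub_noConveyor`,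
`stub_noSloshing`, `stub_wakeFloor` open).  MODEL lattice only (Tao 2016 §4 renormalised cascade); nothing here is
a statement about the Navier–Stokes equations and no summit is proved by this file.

* `hasDerivAt_finalTail` — for a uniformly bounded admissible INVISCID eternal solution of a cancelling table,
  the physical tail energy `T_n(σ) = Σ_{k≥0} E_{n+k}(σ)` is differentiable in log-time with derivative the
  incoming flux `F_{n-1}(σ)` (termwise differentiation `hasDerivAt_tsum_of_isPreconnected` on `Iio (σ+1)` with
  the geometric flux bounds of the landed `abs_physFlux_le_unif`; the outgoing fluxes `F_{n+K} → 0` telescope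
  away).  This is the derivative computed inside the landed proof of `stub_tailLimit`, made citable.
* `finalTail_monotone`, `noSloshing_oneway`, `noSloshing_oneway_budget` — the ONE-WAY RUNG of the open stub
  `stub_noSloshing`: if the inter-shell flux never reverses (`0 ≤ physFlux ε₀ α W j σ` for all `j, σ`), every
  tail is monotone in log-time, hence never exceeds its final value `T n`; so `NoSloshing`'s inner inequality
  holds with budget `γ = 0` and a fortiori with every `γ ≥ 0` (the registered stub asks `γ = 1/6`).  The content
  of `stub_noSloshing` beyond this rung is the BACKSCATTERING regime (sign-changing flux), where instrument
  E-g10-2 (evidence on ⟨25646⟩) reads lifts above `(1+ε₀)^{1/6}` on the certified table `tao2rot ∈ E₂(4)`.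
* `noTotalReturn_oneway`, `liftRatio_oneway` — the two extra cuts of the (unregistered) v5 «lift-ratio ledger»
  hold in the same one-way regime: a vanishing final tail vanishes at all log-times, and the division-free
  lift-ratio inequality `T_{n+1}(σ)·T(n) ≤ (1+ε₀)^γ·T(n+1)·T_n(σ′)` holds for every `γ > 0` with a late witness `σ′`.
-/

set_option linter.dupNamespace false

open Filter Topology Set
open Literature.Analysis.FluidPDE.TaoCascade

namespace Summit.NavierStokesRegularity.NavierStokesRegularity.Cruxes.EternalInviscidRate.FinalWakeLedger

/-- **The tail derivative is the incoming flux:** `d/dσ Σ_{k≥0} E_{n+k}(σ) = F_{n-1}(σ)` for a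
uniformly bounded eternal solution of a cancelling table. -/
theorem hasDerivAt_finalTail {ε₀ : ℝ} (hε : 0 < ε₀) {α : Fin 4 → Fin 4 → Fin 4 → ℤ × ℤ × ℤ → ℝ}
    (hc : IsCancellingCoeff α) {W : ℤ → ℝ → Em 4} (hW : IsEternal ε₀ α W) (hU : UniformBound W)
    (n : ℤ) (σ : ℝ) :
    HasDerivAt (fun z => ∑' k : ℕ, physEnergy ε₀ W (n + k) z) (physFlux ε₀ α W (n - 1) σ) σ := by
  have hWv : IsEternalVisc ε₀ 0 α W := hW.isEternalVisc
  obtain ⟨C, hC⟩ := hU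
  have hΛ : 0 < bigLam ε₀ := bigLam_pos (by linarith)
  have hΛ1 : 1 < bigLam ε₀ := EternalViscousRate.DissipationEdge.one_lt_bigLam hε
  have hCA : 0 ≤ fluxConst α := fluxConst_nonneg α
  have hC0 : 0 ≤ C := (norm_nonneg _).trans (hC 0 0)
  -- shell energies and their derivatives (inviscid: no dissipation term)
  set g : ℕ → ℝ → ℝ := fun k σ => physEnergy ε₀ W (n + k) σ with hg
  set F : ℕ → ℝ → ℝ := fun k σ => physFlux ε₀ α W (n - 1 + k) σ with hF
  set g' : ℕ → ℝ → ℝ := fun k σ => F k σ - F (k + 1) σ with hg'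
  have hder : ∀ (k : ℕ) (σ : ℝ), HasDerivAt (g k) (g' k σ) σ := by
    intro k σ
    have h := hasDerivAt_physEnergy hε hWv hc (n + k) σ
    refine h.congr_deriv ?_
    have e1 : n + (k : ℤ) - 1 = n - 1 + k := by ring
    have e2 : n + (k : ℤ) = n - 1 + ((k + 1 : ℕ) : ℤ) := by push_cast; ring
    simp only [hg', hF, viscCoef, zero_mul, mul_zero, sub_zero]
    rw [e1, ← e2]
  -- geometric ratio
  set r : ℝ := ((bigLam ε₀)⁻¹) ^ 2 with hr
  have hr0 : 0 ≤ r := by positivity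
  have hr1 : r < 1 := by
    have h1 : (bigLam ε₀)⁻¹ < 1 := inv_lt_one_of_one_lt₀ hΛ1
    have h2 : 0 ≤ (bigLam ε₀)⁻¹ := inv_nonneg.mpr hΛ.le
    calc r = (bigLam ε₀)⁻¹ ^ 2 := hr
      _ < 1 ^ 2 := pow_lt_pow_left₀ h1 h2 (by norm_num)
      _ = 1 := one_pow 2
  have hsplit : ∀ (j : ℤ) (k : ℕ), (bigLam ε₀ ^ (j + (k : ℤ)))⁻¹ ^ 2 = (bigLam ε₀ ^ j)⁻¹ ^ 2 * r ^ k := by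
    intro j k
    rw [hr, zpow_add₀ hΛ.ne', zpow_natCast, mul_inv, mul_pow]
    congr 1
    rw [← inv_pow, ← pow_mul, ← pow_mul, mul_comm]
  -- flux bound below a log-time `b`: |F k y| ≤ A b * r^k
  set c : ℝ := 2 * fluxConst α * (bigLam ε₀)⁻¹ * C with hc_def
  have hc0' : 0 ≤ c := by rw [hc_def]; positivity
  have hFb : ∀ (b : ℝ) (k : ℕ) (y : ℝ), y ≤ b →
      |F k y| ≤ c * ((bigLam ε₀ ^ (n - 1))⁻¹ ^ 2 * (Real.exp (2 * b) * C ^ 2)) * r ^ k := by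
    intro b k y hy
    have h := abs_physFlux_le_unif hε hc hC (n - 1 + k) hy
    rw [hsplit (n - 1) k] at h
    calc |F k y| = |physFlux ε₀ α W (n - 1 + k) y| := by rw [hF]
      _ ≤ 2 * fluxConst α * (bigLam ε₀)⁻¹ * C *
            ((bigLam ε₀ ^ (n - 1))⁻¹ ^ 2 * r ^ k * (Real.exp (2 * b) * C ^ 2)) := h
      _ = c * ((bigLam ε₀ ^ (n - 1))⁻¹ ^ 2 * (Real.exp (2 * b) * C ^ 2)) * r ^ k := by
            rw [hc_def]; ring
  -- F k σ → 0 as k → ∞ (fixed σ)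
  have hFlim : ∀ σ : ℝ, Tendsto (fun k : ℕ => F k σ) atTop (𝓝 0) := by
    intro σ
    set A : ℝ := c * ((bigLam ε₀ ^ (n - 1))⁻¹ ^ 2 * (Real.exp (2 * σ) * C ^ 2)) with hA
    have hgeo : Tendsto (fun k : ℕ => A * r ^ k) atTop (𝓝 0) := by
      have := (tendsto_pow_atTop_nhds_zero_of_lt_one hr0 hr1).const_mul A
      simpa using this
    refine squeeze_zero_norm (fun k => ?_) hgeo
    rw [Real.norm_eq_abs]
    exact hFb σ k σ le_rfl
  -- termwise differentiation of the tail on `Iio (σ + 1)`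
  have hsum0 : ∀ σ : ℝ, Summable (fun k : ℕ => g k σ) := by
    intro σ
    exact summable_physEnergy_tail_unif hε ⟨C, hC⟩ n σ
  have hT : ∀ σ : ℝ, HasDerivAt (fun z => ∑' k : ℕ, g k z) (∑' k : ℕ, g' k σ) σ := by
    intro σ
    set b : ℝ := σ + 1 with hb
    set A : ℝ := c * ((bigLam ε₀ ^ (n - 1))⁻¹ ^ 2 * (Real.exp (2 * b) * C ^ 2)) with hA
    have hA0 : 0 ≤ A := by rw [hA]; positivity
    have hu : Summable (fun k : ℕ => A * r ^ k + A * r ^ (k + 1)) :=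
      ((summable_geometric_of_lt_one hr0 hr1).mul_left A).add
        (((summable_geometric_of_lt_one hr0 hr1).mul_left (A * r)).congr fun k => by ring)
    refine hasDerivAt_tsum_of_isPreconnected hu isOpen_Iio isPreconnected_Iio
      (fun k y _ => hder k y) (fun k y hy => ?_) (show σ ∈ Iio b by simp [hb]) (hsum0 σ)
      (show σ ∈ Iio b by simp [hb])
    have hy' : y ≤ b := le_of_lt hy
    calc ‖g' k y‖ = |F k y - F (k + 1) y| := by rw [hg', Real.norm_eq_abs]
      _ ≤ |F k y| + |F (k + 1) y| := abs_sub _ _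
      _ ≤ A * r ^ k + A * r ^ (k + 1) := add_le_add (hFb b k y hy') (hFb b (k + 1) y hy')
  -- the derivative telescopes to the incoming flux `F 0 = F_{n-1}`
  have htele : ∀ σ : ℝ, ∑' k : ℕ, g' k σ = F 0 σ := by
    intro σ
    have hs : Summable (fun k : ℕ => g' k σ) := by
      set A : ℝ := c * ((bigLam ε₀ ^ (n - 1))⁻¹ ^ 2 * (Real.exp (2 * σ) * C ^ 2)) with hA
      have hu : Summable (fun k : ℕ => A * r ^ k + A * r ^ (k + 1)) :=
        ((summable_geometric_of_lt_one hr0 hr1).mul_left A).add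
          (((summable_geometric_of_lt_one hr0 hr1).mul_left (A * r)).congr fun k => by ring)
      refine Summable.of_norm_bounded hu fun k => ?_
      calc ‖g' k σ‖ = |F k σ - F (k + 1) σ| := by rw [hg', Real.norm_eq_abs]
        _ ≤ |F k σ| + |F (k + 1) σ| := abs_sub _ _
        _ ≤ A * r ^ k + A * r ^ (k + 1) := add_le_add (hFb σ k σ le_rfl) (hFb σ (k + 1) σ le_rfl)
    have h1 : Tendsto (fun K : ℕ => ∑ k ∈ Finset.range K, g' k σ) atTop (𝓝 (∑' k : ℕ, g' k σ)) :=
      hs.hasSum.tendsto_sum_nat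
    have h2 : Tendsto (fun K : ℕ => ∑ k ∈ Finset.range K, g' k σ) atTop (𝓝 (F 0 σ - 0)) := by
      have heq : (fun K : ℕ => ∑ k ∈ Finset.range K, g' k σ) = fun K => F 0 σ - F K σ := by
        funext K
        rw [hg']
        exact Finset.sum_range_sub' (fun k => F k σ) K
      rw [heq]
      exact tendsto_const_nhds.sub (hFlim σ)
    rw [sub_zero] at h2
    exact tendsto_nhds_unique h1 h2
  have hT' : ∀ σ : ℝ, HasDerivAt (fun z => ∑' k : ℕ, g k z) (F 0 σ) σ := fun σ =>
    (hT σ).congr_deriv (htele σ)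
  have h := hT' σ
  simp only [hF, Nat.cast_zero, add_zero] at h
  exact h

/-- **One-way ⇒ monotone tails.** -/
theorem finalTail_monotone {ε₀ : ℝ} (hε : 0 < ε₀) {α : Fin 4 → Fin 4 → Fin 4 → ℤ × ℤ × ℤ → ℝ}
    (hc : IsCancellingCoeff α) {W : ℤ → ℝ → Em 4} (hW : IsEternal ε₀ α W) (hU : UniformBound W)
    (hF : ∀ (j : ℤ) (σ : ℝ), 0 ≤ physFlux ε₀ α W j σ) (n : ℤ) :
    Monotone (fun σ => ∑' k : ℕ, physEnergy ε₀ W (n + k) σ) := by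
  refine monotone_of_deriv_nonneg (fun σ => (hasDerivAt_finalTail hε hc hW hU n σ).differentiableAt) ?_
  intro σ
  rw [(hasDerivAt_finalTail hε hc hW hU n σ).deriv]
  exact hF _ _

/-- **`stub_noSloshing` in the one-way case, with budget `γ = 0`:** the tail never exceeds its final
value. -/
theorem noSloshing_oneway {ε₀ : ℝ} (hε : 0 < ε₀) {α : Fin 4 → Fin 4 → Fin 4 → ℤ × ℤ × ℤ → ℝ}
    (hc : IsCancellingCoeff α) {W : ℤ → ℝ → Em 4} (hW : IsEternal ε₀ α W) (hU : UniformBound W)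
    (hF : ∀ (j : ℤ) (σ : ℝ), 0 ≤ physFlux ε₀ α W j σ) (n : ℤ) {L : ℝ}
    (hL : Tendsto (fun σ => ∑' k : ℕ, physEnergy ε₀ W (n + k) σ) atTop (𝓝 L)) (σ : ℝ) :
    ∑' k : ℕ, physEnergy ε₀ W (n + k) σ ≤ L :=
  (finalTail_monotone hε hc hW hU hF n).ge_of_tendsto hL σ

/-- The same in `NoSloshing`'s exact shape, for any budget `γ ≥ 0`. -/
theorem noSloshing_oneway_budget {ε₀ : ℝ} (hε : 0 < ε₀) {α : Fin 4 → Fin 4 → Fin 4 → ℤ × ℤ × ℤ → ℝ}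
    (hc : IsCancellingCoeff α) {W : ℤ → ℝ → Em 4} (hW : IsEternal ε₀ α W) (hU : UniformBound W)
    (hF : ∀ (j : ℤ) (σ : ℝ), 0 ≤ physFlux ε₀ α W j σ) {γ : ℝ} (hγ : 0 ≤ γ) (T : ℤ → ℝ)
    (hT : ∀ n : ℤ, Tendsto (fun σ => ∑' k : ℕ, physEnergy ε₀ W (n + k) σ) atTop (𝓝 (T n)))
    (n : ℤ) (σ : ℝ) :
    ∑' k : ℕ, physEnergy ε₀ W (n + k) σ ≤ (1 + ε₀) ^ γ * T n := by
  have h1 : ∑' k : ℕ, physEnergy ε₀ W (n + k) σ ≤ T n := noSloshing_oneway hε hc hW hU hF n (hT n) σ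
  have hT0 : 0 ≤ T n :=
    ge_of_tendsto' (hT n) fun σ => tsum_nonneg fun k => physEnergy_nonneg _ _ _ _
  have hpow : 1 ≤ (1 + ε₀) ^ γ := Real.one_le_rpow (by linarith) hγ
  nlinarith

/-- **v5 stub `stub_noTotalReturn` in the one-way case:** a vanishing final tail forces a vanishing
tail at every log-time (tails are monotone and nonnegative). -/
theorem noTotalReturn_oneway {ε₀ : ℝ} (hε : 0 < ε₀) {α : Fin 4 → Fin 4 → Fin 4 → ℤ × ℤ × ℤ → ℝ}
    (hc : IsCancellingCoeff α) {W : ℤ → ℝ → Em 4} (hW : IsEternal ε₀ α W) (hU : UniformBound W)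
    (hF : ∀ (j : ℤ) (σ : ℝ), 0 ≤ physFlux ε₀ α W j σ) (T : ℤ → ℝ)
    (hT : ∀ n : ℤ, Tendsto (fun σ => ∑' k : ℕ, physEnergy ε₀ W (n + k) σ) atTop (𝓝 (T n)))
    (n : ℤ) (hn : T n = 0) (σ : ℝ) :
    ∑' k : ℕ, physEnergy ε₀ W (n + k) σ = 0 := by
  have h1 : ∑' k : ℕ, physEnergy ε₀ W (n + k) σ ≤ T n := noSloshing_oneway hε hc hW hU hF n (hT n) σ
  have h0 : 0 ≤ ∑' k : ℕ, physEnergy ε₀ W (n + k) σ := tsum_nonneg fun k => physEnergy_nonneg _ _ _ _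
  linarith

/-- **v5 stub `stub_liftRatio` in the one-way case, for every budget `γ > 0`:** the division-free
lift-ratio inequality `T_{n+1}(σ)·T(n) ≤ (1+ε₀)^γ · T(n+1) · T_n(σ')` holds with a late enough witness
log-time `σ'` (one-way lifts are all equal to 1; the slack `γ > 0` pays for approaching the limit). -/
theorem liftRatio_oneway {ε₀ : ℝ} (hε : 0 < ε₀) {α : Fin 4 → Fin 4 → Fin 4 → ℤ × ℤ × ℤ → ℝ}
    (hc : IsCancellingCoeff α) {W : ℤ → ℝ → Em 4} (hW : IsEternal ε₀ α W) (hU : UniformBound W)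
    (hF : ∀ (j : ℤ) (σ : ℝ), 0 ≤ physFlux ε₀ α W j σ) {γ : ℝ} (hγ : 0 < γ) (T : ℤ → ℝ)
    (hT : ∀ n : ℤ, Tendsto (fun σ => ∑' k : ℕ, physEnergy ε₀ W (n + k) σ) atTop (𝓝 (T n)))
    (n : ℤ) (σ : ℝ) :
    ∃ σ' : ℝ, (∑' k : ℕ, physEnergy ε₀ W (n + 1 + k) σ) * T n
      ≤ (1 + ε₀) ^ γ * (T (n + 1) * ∑' k : ℕ, physEnergy ε₀ W (n + k) σ') := by
  have htail0 : ∀ (j : ℤ) (s : ℝ), 0 ≤ ∑' k : ℕ, physEnergy ε₀ W (j + k) s :=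
    fun j s => tsum_nonneg fun k => physEnergy_nonneg _ _ _ _
  have hT0 : ∀ j : ℤ, 0 ≤ T j := fun j => ge_of_tendsto' (hT j) fun s => htail0 j s
  have hup : ∑' k : ℕ, physEnergy ε₀ W (n + 1 + k) σ ≤ T (n + 1) :=
    noSloshing_oneway hε hc hW hU hF (n + 1) (hT (n + 1)) σ
  have hpow : 1 < (1 + ε₀) ^ γ := Real.one_lt_rpow (by linarith) hγ
  rcases (hT0 n).eq_or_lt with hz | hpos
  · refine ⟨σ, ?_⟩
    rw [← hz, mul_zero]
    exact mul_nonneg (by linarith) (mul_nonneg (hT0 _) (htail0 _ _))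
  · -- pick σ' late enough that (1+ε₀)^γ · T_n(σ') > T(n)
    have hlt : T n / (1 + ε₀) ^ γ < T n := div_lt_self hpos hpow
    obtain ⟨σ', hσ'⟩ := ((hT n).eventually_const_lt hlt).exists
    refine ⟨σ', ?_⟩
    have hγ0 : 0 < (1 + ε₀) ^ γ := by linarith
    have h2 : T n < (1 + ε₀) ^ γ * ∑' k : ℕ, physEnergy ε₀ W (n + k) σ' := by
      have := (div_lt_iff₀ hγ0).mp hσ'
      linarith [this]
    calc (∑' k : ℕ, physEnergy ε₀ W (n + 1 + k) σ) * T n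
        ≤ T (n + 1) * T n := mul_le_mul_of_nonneg_right hup (hT0 n)
      _ ≤ T (n + 1) * ((1 + ε₀) ^ γ * ∑' k : ℕ, physEnergy ε₀ W (n + k) σ') :=
          mul_le_mul_of_nonneg_left h2.le (hT0 _)
      _ = (1 + ε₀) ^ γ * (T (n + 1) * ∑' k : ℕ, physEnergy ε₀ W (n + k) σ') := by ring

end Summit.NavierStokesRegularity.NavierStokesRegularity.Cruxes.EternalInviscidRate.FinalWakeLedger
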